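import Mathlib
import Summits.CriticalPhenomena.CardyFormulaZ2.Theorems.CardySelfRefinementDefs
import HarnessLib

/-!
# Layer weights and layer algebra for stub `stub_pivotalMass` (line `far-field-is-a-quarter-turn`,
crux `TrivialSectorRate`, stmt-CriticalPhenomena-10266)

Elementary inputs of the dyadic-layer summation (`…StubPivotalMassSummation.lean`):
the layer weight `wt = rη / max(bdist, rη)` satisfies `0 ≤ wt ≤ 1` and `wt ≤ rη/d` once `d ≤ bdist`
(`wt_le_div`, the registered helper); `min(1, x^b) ≤ x^{b'}` for `0 ≤ b' ≤ b`; the layer algebra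
`r/(8X) · A · (r₁/X)^{1+ε} · C (8X)² (8Xη)^{b'} ≤ 8^{1+b'} r A C r₁^{1+ε} X^{−ε/2} η^{b'}` for `X ≥ 1`,
`b' − ε ≤ −ε/2`; and the geometric decay `(2^j R₀)^{−ε/2} ≤ (2^{−ε/2})^j`.
-/

noncomputable section

namespace Summit.CriticalPhenomena.CardyFormulaZ2.Theorems.CardySelfRefinement.FarField

open scoped Topology
open Filter Set MeasureTheory
open Literature.Probability.LatticeModels Literature.Probability.Percolation
open Literature.Probability.Percolation.QuadCrossing
open Summit.CriticalPhenomena.CardyFormulaZ2.Theses.CardySelfRefinement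

/-! ## Real-variable lemmas -/

/-- `min(1, x^b) ≤ x^{b'}` for `0 ≤ b' ≤ b`, `x > 0` (both branches). -/
theorem min_one_rpow_le_rpow {x b b' : ℝ} (hx : 0 < x) (hb' : 0 ≤ b') (hb'b : b' ≤ b) :
    min 1 (x ^ b) ≤ x ^ b' := by
  rcases le_or_gt x 1 with h | h
  · exact (min_le_right _ _).trans (Real.rpow_le_rpow_of_exponent_ge hx h hb'b)
  · exact (min_le_left _ _).trans (Real.one_le_rpow h.le hb')

/-- The layer algebra: weight `r/(8X)` × four arms `(r₁/X)^{1+ε}` × relevance mass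
`C (8X)² (8Xη)^{b'}` is `8^{1+b'} r A C r₁^{1+ε} X^{b'−ε} η^{b'} ≤ … X^{−ε/2} …` for `X ≥ 1`,
`b' − ε ≤ −ε/2`. -/
theorem layer_algebra {ε b' r r₁ A C X η : ℝ} (hX : 1 ≤ X) (hη : 0 < η) (hr : 0 ≤ r) (hr₁ : 0 ≤ r₁)
    (hA : 0 ≤ A) (hC : 0 ≤ C) (hε : b' - ε ≤ -(ε / 2)) :
    r / (8 * X) * A * (r₁ / X) ^ (1 + ε) * (C * (8 * X) ^ 2 * (8 * X * η) ^ b') ≤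
      (8 : ℝ) ^ (1 + b') * r * A * C * r₁ ^ (1 + ε) * X ^ (-(ε / 2)) * η ^ b' := by
  have hX0 : 0 < X := by linarith
  have h1 : (r₁ / X) ^ (1 + ε) = r₁ ^ (1 + ε) / X ^ (1 + ε) := Real.div_rpow hr₁ hX0.le _
  have h2 : (8 * X * η) ^ b' = 8 ^ b' * X ^ b' * η ^ b' := by
    rw [Real.mul_rpow (by positivity) hη.le, Real.mul_rpow (by norm_num) hX0.le]
  have h3 : (8 : ℝ) ^ (1 + b') = 8 * 8 ^ b' := by
    rw [Real.rpow_add (by norm_num), Real.rpow_one]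
  have hkey : X ^ 2 * X ^ b' / (X * X ^ (1 + ε)) = X ^ (b' - ε) := by
    have : b' - ε = (2 + b') - (1 + (1 + ε)) := by ring
    rw [this, Real.rpow_sub hX0, Real.rpow_add hX0 2 b', Real.rpow_add hX0 1 (1 + ε), Real.rpow_two,
      Real.rpow_one]
  have hmono : X ^ (b' - ε) ≤ X ^ (-(ε / 2)) := Real.rpow_le_rpow_of_exponent_le hX hε
  have hXe : X ^ (1 + ε) ≠ 0 := (Real.rpow_pos_of_pos hX0 _).ne'
  calc r / (8 * X) * A * (r₁ / X) ^ (1 + ε) * (C * (8 * X) ^ 2 * (8 * X * η) ^ b')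
      = 8 ^ (1 + b') * r * A * C * r₁ ^ (1 + ε) * (X ^ 2 * X ^ b' / (X * X ^ (1 + ε))) * η ^ b' := by
        rw [h1, h2, h3]
        field_simp
    _ = 8 ^ (1 + b') * r * A * C * r₁ ^ (1 + ε) * X ^ (b' - ε) * η ^ b' := by rw [hkey]
    _ ≤ 8 ^ (1 + b') * r * A * C * r₁ ^ (1 + ε) * X ^ (-(ε / 2)) * η ^ b' := by gcongr

/-- Geometric decay of the layer factor: `(2^j R₀)^{−ε/2} ≤ (2^{−ε/2})^j` for `R₀ ≥ 1`. -/
theorem rpow_neg_le_geom {ε : ℝ} (hε : 0 < ε) {R₀ : ℕ} (hR₀ : 1 ≤ R₀) (j : ℕ) :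
    ((2 ^ j * R₀ : ℕ) : ℝ) ^ (-(ε / 2)) ≤ ((2 : ℝ) ^ (-(ε / 2))) ^ j := by
  have h2j : (0 : ℝ) < 2 ^ j := by positivity
  have hle : (2 : ℝ) ^ j ≤ ((2 ^ j * R₀ : ℕ) : ℝ) := by
    have : (1 : ℝ) ≤ R₀ := by exact_mod_cast hR₀
    push_cast
    nlinarith
  calc ((2 ^ j * R₀ : ℕ) : ℝ) ^ (-(ε / 2)) ≤ ((2 : ℝ) ^ j) ^ (-(ε / 2)) :=
        Real.rpow_le_rpow_of_nonpos h2j hle (by linarith)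
    _ = ((2 : ℝ) ^ (-(ε / 2))) ^ j := by
        rw [← Real.rpow_natCast 2 j, ← Real.rpow_mul (by norm_num), mul_comm, Real.rpow_mul (by norm_num),
          Real.rpow_natCast]

/-! ## Elementary facts on the weight -/

/-- `0 ≤ wt` for `η > 0`, `r > 0`. -/
theorem wt_nonneg' (k m : ℕ) (F : Fin m → Quad (univ : Set ℂ)) {η r : ℝ} (hη : 0 < η) (hr : 0 < r)
    (u : Site 2) : 0 ≤ wt k m F η r u := by
  unfold wt
  have : 0 < max (bdist k m F η u) (r * η) := lt_max_of_lt_right (by positivity)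
  positivity

/-- `wt ≤ 1` for `η > 0`, `r > 0`. -/
theorem wt_le_one (k m : ℕ) (F : Fin m → Quad (univ : Set ℂ)) {η r : ℝ} (hη : 0 < η) (hr : 0 < r)
    (u : Site 2) : wt k m F η r u ≤ 1 := by
  unfold wt
  have hpos : 0 < r * η := by positivity
  rw [div_le_one (lt_max_of_lt_right hpos)]
  exact le_max_right _ _

/-- **Layer weight bound** (registered helper of `stub_pivotalMass`): below the contact layer the
weight is at most `rη / bdist ≤ rη / d` for any `0 < d ≤ bdist`. -/
theorem wt_le_div (k m : ℕ) (F : Fin m → Quad (univ : Set ℂ)) {η r d : ℝ} (hη : 0 < η) (hr : 0 < r)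
    (hd : 0 < d) {u : Site 2} (hdu : d ≤ bdist k m F η u) : wt k m F η r u ≤ r * η / d := by
  unfold wt
  exact div_le_div_of_nonneg_left (by positivity) hd (hdu.trans (le_max_left _ _))

end Summit.CriticalPhenomena.CardyFormulaZ2.Theorems.CardySelfRefinement.FarField

end
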